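import Mathlib

/-!
# Route `BinomialElusive`, crux `PeelingLemma` (stmt-ValiantsHypothesis-7391) — vocabulary of the
negative lane "deterministic all-X designs", part 3: SCHOTTKY GENERATORS in `SL(2,ℤ)` (module [G])

Blueprint `Cruxes/PeelingLemma/DETERMINISTIC-ALLX.md` §5.  The high-girth letter incidence of the
refutation is the Cayley graph of `SL(2, 𝔽_p)` on the images of `D` unipotent matrices
`T(4), T(8), …, T(4D)`, `T(m) = P(m) B P(m)⁻¹` with `B = [[1,0],[2,1]]`, `P(m) = [[1,m],[0,1]]`, which
generate a FREE subgroup of `SL(2,ℤ)` by Schottky ping-pong on nonzero integer vectors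
(`BinomialElusivePeelingLemmaSchottky.lean`, `injective_lift_gen`, via Mathlib's
`FreeGroup.injective_lift_of_ping_pong`): each `T(m)` fixes the direction `(m, 1)`; in the adapted
coordinate `x' = x - m y` it acts as `(x', y) ↦ (x', y + 2x')`, with attracting half-cones
`coneX m ⊔ coneY m = {|x'| ≤ |y|} ∖ 0`, and cones of parameters `≥ 3` apart meet only in `0`.
[Classical: Sanov 1947; Margulis 1982; Davidoff–Sarnak–Valette, App. A.]  Nothing here asserts anything.
-/

-- `Summit.ValiantsHypothesis.ValiantsHypothesis.…` is the tree's mandated single-conjunct layout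
-- (Sub = Summit), so the duplicated namespace component is intended.
set_option linter.dupNamespace false

namespace Summit.ValiantsHypothesis.ValiantsHypothesis.Theorems.PeelingLemmaSchottky

open Matrix

/-- The unipotent matrix `T(m) = [[1+2m, -2m²],[2, 1-2m]] = P(m) B P(m)⁻¹` (`B = [[1,0],[2,1]]`,
`P(m) = [[1,m],[0,1]]`): in the adapted coordinates `(x - m y, y)` it acts as `(x', y) ↦ (x', y + 2x')`. -/
def genMat (m : ℤ) : Matrix.SpecialLinearGroup (Fin 2) ℤ :=
  ⟨!![1 + 2 * m, -2 * m ^ 2; 2, 1 - 2 * m], by rw [Matrix.det_fin_two_of]; ring⟩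

/-- The `D` generators `T(4), T(8), …, T(4D)` (fixed directions `(4(j+1), 1)`, pairwise far apart). -/
def gen (D : ℕ) (j : Fin D) : Matrix.SpecialLinearGroup (Fin 2) ℤ := genMat (4 * ((j : ℤ) + 1))

/-- Nonzero integer vectors, a sub-action of `SL(2,ℤ)` on `ℤ²`. -/
def nonzeroSub : SubMulAction (Matrix.SpecialLinearGroup (Fin 2) ℤ) (Fin 2 → ℤ) where
  carrier := {v | v ≠ 0}
  smul_mem' := by
    intro g v hv h
    apply hv
    have : g⁻¹ • g • v = g⁻¹ • (0 : Fin 2 → ℤ) := by rw [h]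
    rwa [inv_smul_smul, smul_zero] at this

/-- The adapted coordinate `x' = x - m y` of the generator `T(m)`. -/
def adapted (m : ℤ) (v : Fin 2 → ℤ) : ℤ := v 0 - m * v 1

/-- Attracting Schottky set of `T(m)`: the half-cone `|y| ≥ |x'|, x' y > 0` together with the fixed
line `x' = 0`. -/
def coneX (m : ℤ) : Set nonzeroSub :=
  {v | (|adapted m v.1| ≤ |v.1 1| ∧ 0 < adapted m v.1 * v.1 1) ∨ adapted m v.1 = 0}

/-- Attracting Schottky set of `T(m)⁻¹`: the half-cone `|y| ≥ |x'|, x' y < 0`. -/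
def coneY (m : ℤ) : Set nonzeroSub :=
  {v | |adapted m v.1| ≤ |v.1 1| ∧ adapted m v.1 * v.1 1 < 0}

end Summit.ValiantsHypothesis.ValiantsHypothesis.Theorems.PeelingLemmaSchottky
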